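import Mathlib.Data.Fin.VecNotation
import Mathlib.Data.Nat.Bitwise
import Mathlib.Data.Fintype.Basic
import HarnessLib

/-!
# Rank-four faces of a Galois CM field in the finite model `(G, c)` — types, places, corners, type squares, Galois twists,
# eigenvector labels and the face classes as Pohlmann exponent vectors (generic kernel engine over a Cayley table)

COR-CM (cell `pub-hodgecm2`), count-neutral kernel census by seat b30 (gen 17, claim OCTIC-FACE-CENSUS, HOME/lit/LIT-STATUS.md
2026-08-21T12:48:57Z).  This file fixes NO group: it is the common engine of the per-type census files
`Census/OcticFaceSquares*.lean` (the six Galois CM closure types `(G, c)` of order `8`), written so that every census statement is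
a closed `Bool`/`ℕ` computation on numerals that `decide` evaluates in the kernel in seconds: the group is a CAYLEY TABLE on `Fin n`
(`CMGaloisType`; each per-type file certifies its table against the Mathlib group by `decide`), a CM type / label is a BITMASK
`T < 2^n` (bit `i` ↔ the embedding `g_i`), a set of types (a type square, a corner set) is a SORTED `List ℕ`.  It re-reads, for a
general finite group, the models of `Census/CyclicSexticFaces.lean` (`ℤ/6`) and of the OCTIC ATLAS `Census/Octic*Species.lean`
(André-3).  Definitions only; nothing is asserted here.

MODEL [folklore].  `F` a Galois CM field, `G = Gal(F/ℚ) = {g_0, …, g_{n-1}}`, one embedding `σ₀ : F → ℚ̄ ⊂ ℂ` fixed, so that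
`Hom(F, ℂ) = {σ₀ ∘ g} ≅ G`; complex conjugation `c ∈ Z(G)` (`c̄ ∘ σ₀ ∘ g = σ₀ ∘ (c g)`).  A CM type is `T ⊆ G` with `T ⊔ cT = G`
(`isCMType`); the infinite place of `g` is `{g, c g}` (`placeMask`); the flip of `T` at a place is the symmetric difference (`flipAt` =
`xor`, the tree's `CMTypeOps.flip`); the corners and period types of the face `(Φ; π, π′)` are VERBATIM the tree's
`Summit.HodgeConjecture.CorCM.Face.corner` / `Face.psi` (`CorCM/CM/Basic.lean`) read in the model (`corners`, `psi`); the TYPE SQUARE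
of the face is `{Φ, Φ^{(π)}, Φ^{(π′)}, Φ^{(ππ′)}}` (`square`; b07's `CorCM/FaceSquareSymmetry.lean`: on the universe of record `PeriodNV`
depends on the square only).  The Galois twist of the `F`-structure by `g ∈ Aut F = G` is RIGHT translation `T ↦ T·g` (`twist`;
b06's `Face.twist` in `CorCM/CMTwistSemilinear.lean`, and the atlas convention): `A_{T·g}` is the complex torus `A_T` with `F` acting
through `g`; with b06's `Model.periodNV_orbit` one non-zero face period per `G`-orbit of type squares gives every instance of
`PeriodThmF` over `F` (`isSquareOrbitReps` checks a system of orbit representatives, `orbitSize` the orbit lengths).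

LABELS (dictionary with the atlas; [cite: Pohlmann1968, Thm 1] via [cite: GaoUllmo2025, Thm 3.1]; [cite: Milne1999, Prop. 2.1, p. 54]).
`H¹(A_T, ℂ) = ⊕_{s ∈ G} H¹_s` (eigenline of the character `σ₀ ∘ s`).  The right stabiliser `H = Stab(T)` (`stabCard`) cuts out
`K = F^H` and `A_T ~ B^{|H|}` with `B = A_{(K, T/H)}` SIMPLE of dimension `n / 2|H|` (`simpleDim`); `T`, `T′` have isogenous simple
factors iff `T′ = T·g` for some `g` (`sameBlock`).  Across the twists the eigenlines are identified by the atlas LABEL (block, coset of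
`H`); here the label of the eigenline `(T, s)` is encoded REPRESENTATIVE-FREE as the CM type `T·s⁻¹`: `(T, s)` and `(T′, s′)` carry the
same eigenvector of the same simple factor iff `T·s⁻¹ = T′·s′⁻¹` (both sides are invariant under the simultaneous twist `(T·g, s·g)`
and under `s ↦ s·h`, `h ∈ Stab(T)`, and conversely `T·s⁻¹ = T′·s′⁻¹` gives `T′ = T·(s⁻¹s′)`).  In this encoding a label `L` is of Hodge
type `(1,0)` iff `1 ∈ L`; Galois conjugation of eigenvectors by `t` (the atlas's `act`) is `L ↦ L·t⁻¹`; the conjugate (divisor) pair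
of `L` is `{L, L̄ = cL}`; Pohlmann's Hodge form of `t ∈ G` on an exponent vector `m : labels → ℤ` is `Σ_{L ∋ t} m(L) − Σ_{L ∌ t} m(L)`
(`hodgeFormInd` on indicator vectors).  The `s`-eigencomponent of the Weil line `W_F(P(f))` of the corner product `P(f) = ∏ A_{Φᵢ}` (the tree's
`Universe.weilGenerators`: one `s`-eigenvector from each corner) has exponent vector the indicator of `{Φᵢ·s⁻¹}` — for `s = 1` the
CORNER SET itself, in general its twist (`faceLabels`); `SumTwo` (rfwf Lemma 1.2) is exactly the vanishing of all Hodge forms on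
it (`isHodgeIndicator`).  It is a product of divisor classes iff the label set is closed under `L ↦ L̄`; for `[F:ℚ] ≥ 6` no two
corners are even conjugate (`noConjugateCorners`).  Its minimal carrier inside the `F`-slice is one copy of the simple factor of each
block met by the corners (the four labels are pairwise distinct), of dimension `carrierDim`, with Künneth shape `kunnethShape`.

## References
* [Pohlmann1968] H. Pohlmann, Ann. of Math. 88 (1968), Thm 1.  [GaoUllmo2025] Z. Gao, E. Ullmo, JIMJ 25 (2025), Thm 3.1.
* [Milne1999] J. S. Milne, Compositio Math. 117 (1999), Prop. 2.1, p. 54.  rfwf v3 Def. 1.1 / Lemma 1.2 via `CorCM/CM/Basic.lean`.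
-/

namespace Summit.HodgeConjecture.CorCM.Census.FaceSquaresModel

/-- A Galois CM closure type `(G, c)` of order `n` as a CAYLEY TABLE on `Fin n`: `mul i j` is the index of `g_i · g_j`, `one` the
index of the identity, `conj` the index of complex conjugation.  (Group axioms and centrality of `conj` are the `Bool` check
`isCMGaloisType`, certified per type.) [folklore] -/
structure CMGaloisType (n : ℕ) where
  /-- Cayley table -/
  mul : Fin n → Fin n → Fin n
  /-- the identity -/
  one : Fin n
  /-- complex conjugation, a central involution -/
  conj : Fin n

/-! ### `Γ`-independent helpers: bitmasks over `Fin n` -/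

/-- `g_i ∈ T` (bit `i` of the mask `T`). [folklore] -/
def mem {n : ℕ} (i : Fin n) (T : ℕ) : Bool := T.testBit i.val

/-- The singleton mask `{g_i}`. [folklore] -/
def bit {n : ℕ} (i : Fin n) : ℕ := 2 ^ i.val

/-- Image of a type under a map of `G` (as a mask). [folklore] -/
def imageMask {n : ℕ} (f : Fin n → Fin n) (T : ℕ) : ℕ :=
  (List.finRange n).foldl (fun acc i => if mem i T then acc ||| bit (f i) else acc) 0

/-- Flip of a type at a place (both masks): `T ∆ π` — the tree's `CMTypeOps.flip`. [folklore] -/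
def flipAt (π T : ℕ) : ℕ := T ^^^ π

/-- Sorted insertion (structural; `List.mergeSort` is well-founded-recursive and does not reduce under `decide`). [folklore] -/
def insertNat (a : ℕ) : List ℕ → List ℕ
  | [] => [a]
  | b :: l => if a ≤ b then a :: b :: l else b :: insertNat a l

/-- Insertion sort on `ℕ` (structural). [folklore] -/
def sortNat : List ℕ → List ℕ
  | [] => []
  | a :: l => insertNat a (sortNat l)

/-- A set of types in normal form: sorted, duplicates removed. [folklore] -/
def normalize (S : List ℕ) : List ℕ := (sortNat S).eraseDups

/-- Sorted insertion of pairs, lexicographic (structural). [folklore] -/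
def insertPair (a : ℕ × ℕ) : List (ℕ × ℕ) → List (ℕ × ℕ)
  | [] => [a]
  | b :: l => if a.1 < b.1 ∨ (a.1 = b.1 ∧ a.2 ≤ b.2) then a :: b :: l else b :: insertPair a l

/-- Insertion sort of pairs, lexicographic (structural). [folklore] -/
def sortPairs : List (ℕ × ℕ) → List (ℕ × ℕ)
  | [] => []
  | a :: l => insertPair a (sortPairs l)

/-- The four period types of the face `f = (Φ, π, π′)` (masks), VERBATIM `Face.psi`: `Φ, Φ^{(ππ′)}, Φ^{(π)}, Φ^{(π′)}`. [folklore] -/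
def psi (f : ℕ × ℕ × ℕ) : List ℕ := [f.1, flipAt f.2.2 (flipAt f.2.1 f.1), flipAt f.2.1 f.1, flipAt f.2.2 f.1]

/-- The type square `{Φ, Φ^{(π)}, Φ^{(π′)}, Φ^{(ππ′)}}` of the face, in normal form. [folklore] -/
def square (f : ℕ × ℕ × ℕ) : List ℕ :=
  normalize [f.1, flipAt f.2.1 f.1, flipAt f.2.2 f.1, flipAt f.2.2 (flipAt f.2.1 f.1)]

/-- Pohlmann's Hodge form of `g_t` on the INDICATOR vector of a list of labels: `#{L ∋ t} − #{L ∌ t}`. [cite: Pohlmann1968, Thm 1] -/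
def hodgeFormInd {n : ℕ} (t : Fin n) (S : List ℕ) : ℤ :=
  ((S.filter fun L => mem t L).length : ℤ) - ((S.filter fun L => !mem t L).length : ℤ)

/-- The indicator of `S` is a Hodge exponent vector for a group of order `n`: all `n` forms vanish. [cite: Pohlmann1968, Thm 1] -/
def isHodgeIndicator (n : ℕ) (S : List ℕ) : Bool := (List.finRange n).all fun t => hodgeFormInd t S == 0

/-- The members of a mask, as indices in `Fin n`. [folklore] -/
def decode (n : ℕ) (T : ℕ) : List (Fin n) := (List.finRange n).filter fun i => mem i T

/-- The mask of a list of indices. [folklore] -/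
def encode {n : ℕ} (l : List (Fin n)) : ℕ := l.foldl (fun acc i => acc ||| bit i) 0

namespace CMGaloisType

variable {n : ℕ} (Γ : CMGaloisType n)

/-- `Bool` check of the axioms: associativity, two-sided identity, existence of inverses, `conj` a central involution `≠ 1`. [folklore] -/
def isCMGaloisType : Bool :=
  ((List.finRange n).all fun i => (List.finRange n).all fun j => (List.finRange n).all fun k => Γ.mul (Γ.mul i j) k == Γ.mul i (Γ.mul j k)) &&
  ((List.finRange n).all fun i => Γ.mul Γ.one i == i && Γ.mul i Γ.one == i) &&
  ((List.finRange n).all fun i => (List.finRange n).any fun j => Γ.mul i j == Γ.one) &&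
  ((List.finRange n).all fun i => Γ.mul Γ.conj i == Γ.mul i Γ.conj) && (Γ.mul Γ.conj Γ.conj == Γ.one) && !(Γ.conj == Γ.one)

/-- The inverse (by search; junk `one` if none). [folklore] -/
def inv (i : Fin n) : Fin n := ((List.finRange n).find? fun j => Γ.mul i j == Γ.one).getD Γ.one

/-! ### Types as bitmasks -/

/-- `T` is a CM type: for every `g`, exactly one of `g`, `c g` lies in `T` (and no bit beyond `n`). [folklore] -/
def isCMType (T : ℕ) : Bool := (T < 2 ^ n) && (List.finRange n).all fun i => mem i T != mem (Γ.mul Γ.conj i) T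

/-- The `2^{n/2}` CM types, increasing. [folklore] -/
def cmTypes : List ℕ := (List.range (2 ^ n)).filter Γ.isCMType

/-- The place `{g, c g}` of `g` as a mask. [folklore] -/
def placeMask (i : Fin n) : ℕ := bit i ||| bit (Γ.mul Γ.conj i)

/-- The `n/2` places, increasing, without repetition. [folklore] -/
def places : List ℕ := normalize ((List.finRange n).map Γ.placeMask)

/-- Conjugate type `T̄ = cT`. [folklore] -/
def bar (T : ℕ) : ℕ := imageMask (fun i => Γ.mul Γ.conj i) T

/-- Galois twist by `g_j`: right translation `T ↦ T·g_j`. [folklore] -/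
def twist (j : Fin n) (T : ℕ) : ℕ := imageMask (fun i => Γ.mul i j) T

/-! ### Faces, corners, squares -/

/-- The faces `(Φ; π, π′)`: a CM type and an ordered pair of distinct places. [folklore] -/
def faces : List (ℕ × ℕ × ℕ) :=
  Γ.cmTypes.flatMap fun T => Γ.places.flatMap fun p => (Γ.places.filter fun q => q != p).map fun q => (T, p, q)

/-- The four corners, VERBATIM `Face.corner`: `Φ, (Φ̄)^{(π)}, (Φ̄)^{(π′)}, Φ^{(ππ′)}`. [folklore] -/
def corners (f : ℕ × ℕ × ℕ) : List ℕ :=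
  [f.1, flipAt f.2.1 (Γ.bar f.1), flipAt f.2.2 (Γ.bar f.1), flipAt f.2.2 (flipAt f.2.1 f.1)]

/-- The type squares, in normal form, without repetition. [folklore] -/
def squares : List (List ℕ) := (Γ.faces.map square).eraseDups

/-- Twist of a set of types, renormalised. [folklore] -/
def twistSet (j : Fin n) (S : List ℕ) : List ℕ := normalize (S.map (Γ.twist j))

/-- `S′` is a Galois twist of `S`. [folklore] -/
def isTwistOf (S S' : List ℕ) : Bool := (List.finRange n).any fun j => Γ.twistSet j S == S'

/-- Size of the `G`-orbit of a set of types. [folklore] -/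
def orbitSize (S : List ℕ) : ℕ := (((List.finRange n).map fun j => Γ.twistSet j S).eraseDups).length

/-- `reps` (faces) represent the `G`-orbits of type squares: every square is a twist of the square of some representative, the
representatives are faces, and their squares are pairwise inequivalent. [folklore] -/
def isSquareOrbitReps (reps : List (ℕ × ℕ × ℕ)) : Bool :=
  (Γ.squares.all fun S => reps.any fun r => Γ.isTwistOf (square r) S) && (reps.all fun r => Γ.faces.contains r) &&
  ((List.finRange reps.length).all fun a => (List.finRange reps.length).all fun b =>
    a == b || !(Γ.isTwistOf (square (reps.getD a.val (0,0,0))) (square (reps.getD b.val (0,0,0)))))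

/-- `SumTwo` (rfwf Lemma 1.2): every embedding lies in exactly two corners. [folklore] -/
def sumTwo (f : ℕ × ℕ × ℕ) : Bool := (List.finRange n).all fun i => ((Γ.corners f).filter fun T => mem i T).length == 2

/-- The corners are four pairwise distinct CM types. [folklore] -/
def cornersWF (f : ℕ × ℕ × ℕ) : Bool := (Γ.corners f).all Γ.isCMType && (Γ.corners f).eraseDups.length == 4

/-! ### Simple factors -/

/-- `|Stab(T)|`, the order of the right stabiliser. [folklore] -/
def stabCard (T : ℕ) : ℕ := ((List.finRange n).filter fun j => Γ.twist j T == T).length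

/-- Dimension `n / 2|Stab T|` of the simple factor of `A_T`. [cite: Milne1999, Prop. 2.1, p. 54] -/
def simpleDim (T : ℕ) : ℕ := n / (2 * Γ.stabCard T)

/-- Same block (isogenous simple factors): `T′ = T·g` for some `g`. [cite: Milne1999, Prop. 2.1, p. 54] -/
def sameBlock (T T' : ℕ) : Bool := (List.finRange n).any fun j => Γ.twist j T == T'

/-- One representative per block met by a list of types (first occurrences). [folklore] -/
def blockReps (l : List ℕ) : List ℕ :=
  l.foldl (fun acc T => if acc.any fun T' => Γ.sameBlock T' T then acc else acc ++ [T]) []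

/-- Minimal carrier dimension of the face class: one simple factor per block met by the corners. [folklore] -/
def carrierDim (f : ℕ × ℕ × ℕ) : ℕ := ((Γ.blockReps (Γ.corners f)).map Γ.simpleDim).sum

/-- Künneth shape of the face class on its minimal carrier, as the sorted list of pairs (dimension of the simple factor, number of
corners in its block). [folklore] -/
def kunnethShape (f : ℕ × ℕ × ℕ) : List (ℕ × ℕ) :=
  sortPairs ((Γ.blockReps (Γ.corners f)).map fun T => (Γ.simpleDim T, ((Γ.corners f).filter fun T' => Γ.sameBlock T T').length))

/-! ### Labels, Hodge forms, face classes -/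

/-- The label set of the `s`-eigencomponent of the face Weil line: `{Φᵢ · s⁻¹}` (for `s = 1`, the corner set). [folklore] -/
def faceLabels (f : ℕ × ℕ × ℕ) (s : Fin n) : List ℕ := normalize ((Γ.corners f).map (Γ.twist (Γ.inv s)))

/-- No two corners are conjugate (`L̄ ≠ L′` for all corners `L, L′`): the face class has NO divisor-pair factor at all, a fortiori it
is not a product of divisor classes (EXCEPTIONAL). [folklore] -/
def noConjugateCorners (f : ℕ × ℕ × ℕ) : Bool := (Γ.corners f).all fun L => !((Γ.corners f).contains (Γ.bar L))

end CMGaloisType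

end Summit.HodgeConjecture.CorCM.Census.FaceSquaresModel
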